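import Summits.KontsevichZagierPeriods.KontsevichZagierPeriods.Theses.LinRedNormalForm
import Literature.NumberTheory.Transcendental.MultipleZetaValuesDimBoundProofs
import Literature.NumberTheory.Transcendental.MultipleZetaValuesHoffmanProofs
import Literature.NumberTheory.Transcendental.MultipleZetaValuesWeightFourProofs
import Mathlib.LinearAlgebra.Dimension.OrzechProperty
import Mathlib.LinearAlgebra.LinearIndependent.Lemmas

/-!
# Crux `HoffmanIndependence` (stmt-KontsevichZagierPeriods-15045) — the WEIGHT SPLIT
# (crux-strategist, 2026-08-17): grading across weights × independence within each weight

Line `weight_split` of the crux (`Cruxes/HoffmanIndependence/Lines/weight_split.lean`), glue file: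
this is `Cruxes/HoffmanIndependence/Split.lean` landed under `Theorems/` by the line lead
(`--supports stmt-KontsevichZagierPeriods-15045`; it proves the registered stub
`HoffmanIndependence_of_subs` by name and signature). It does NOT close the item: the two
hypotheses of the glue are the line's two registered stubs, both declared open inputs.

The crux `Theses.LinRedNormalForm.HoffmanIndependence` — `ℚ`-linear independence of ALL real Hoffman
values `ζ(u)`, `u ∈ {2,3}^×` (all weights at once, `ζ(∅) = 1` included) — is EXACTLY the
conjunction of two statements of different transcendental kind, each the Hoffman-basis form of a
conjecture printed on its own:

* `HoffmanWeightGrading := iSupIndep hoffmanSpan` — the weight spans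
  `hoffmanSpan n = ℚ⟨ζ(u) : u ∈ {2,3}^×, |u| = n⟩ ⊆ ℝ` form a DIRECT SUM: no `ℚ`-relation between
  Hoffman values of different weights. This is Goncharov's weight-grading conjecture
  (`MZVWeightGradingConjecture = iSupIndep mzvSpace`, GoncharovECM2001 Conj. 1.1 a)) restricted to
  the Hoffman spans (`weightGrading_of_gradingConjecture`, unconditional: `hoffmanSpan n ≤ mzvSpace n`;
  the two agree given Brown's theorem `hoffmanSpan_eq_mzvSpace`). First open instance: weight `≤ 3`,
  `ζ(3) ∉ ℚ + ℚπ²` (`Cruxes/HoffmanIndependence/Disproof.lean` §E `nearMiss_weight_le_three`).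
* `HoffmanInWeightIndependence := ∀ n, LinearIndependent ℚ (ζ on the Hoffman indices of weight n)` —
  WITHIN each weight the `d_n` Hoffman values are independent, i.e. `dim_ℚ hoffmanSpan n = d_n`
  (`inWeight_iff_zagierDim_le_finrank`; the bound `≤ d_n` is the trivial count
  `finrank_hoffmanSpan_le_zagierDim`). This is the lower-bound half of Zagier's dimension conjecture
  in Brown's basis (`inWeight_of_dimensionConjecture`: `ZagierDimensionConjecture` + Brown ⇒ it).
  Known for `n ≤ 4` (`inWeight_of_le_four`); first open instance `n = 5`:
  `{ζ(2,3), ζ(3,2)}` independent ⟺ `ζ(5) ∉ ℚ·ζ(2)ζ(3)` (Disproof §E `nearMiss_weight_five`).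

Main results (all sorry-free, standard axioms):
* `HoffmanIndependence_of_subs : iSupIndep hoffmanSpan → (∀ n, in-weight independence) → HoffmanIndependence`
  — the split glue (`linearIndependent_iUnion_finite` on the `Σ`-reindexing by weight);
* `weightGrading_of_hoffmanIndependence`, `inWeight_of_hoffmanIndependence` — the converses, so the
  split is exact: `hoffmanIndependence_iff_subs`;
* the bridges to the printed conjectures named above, and the unconditional rungs `n ≤ 4`.

No new definitions (the two sub-crux Props are written out verbatim in every signature, exactly as
they are filed on the route by `route edit --split HoffmanIndependence`).
[cite: Zagier1994, §9] [cite: GoncharovECM2001, Conjecture 1.1] [cite: Brown2012, Theorem 1.1] [cite: Hoffman1997]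
-/

noncomputable section

namespace Summit.KontsevichZagierPeriods.LinRedNormalForm.HoffmanIndependence

open Literature.NumberTheory.Transcendental MZV
open Summit.KontsevichZagierPeriods.KontsevichZagierPeriods.Theses.LinRedNormalForm (HoffmanIndependence)

/-! ## Bookkeeping: the weight-`n` Hoffman family spans `hoffmanSpan n` -/

/-- The `ℚ`-span of the range of `u ↦ ζ(u)` over the Hoffman indices of weight `n` is
`hoffmanSpan n` (same generators, written as a range). [folklore] -/
theorem span_range_hoffman_weight (n : ℕ) :
    Submodule.span ℚ (Set.range
      fun u : {u : List ℕ // IsHoffman u ∧ weight u = n} => multipleZeta u.1) = hoffmanSpan n := by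
  unfold hoffmanSpan
  congr 1
  ext x
  simp only [Set.mem_setOf_eq, Set.mem_range, Subtype.exists, exists_prop]
  constructor
  · rintro ⟨s, ⟨hs, hw⟩, rfl⟩
    exact ⟨s, hs, hw, rfl⟩
  · rintro ⟨s, hs, hw, rfl⟩
    exact ⟨s, ⟨hs, hw⟩, rfl⟩

/-- `hoffmanSpan n` is the span of the IMAGE of the weight-`n` slice of the full Hoffman index type
under `u ↦ ζ(u)`. [folklore] -/
theorem hoffmanSpan_eq_span_image (n : ℕ) :
    hoffmanSpan n = Submodule.span ℚ
      ((fun u : {u : List ℕ // IsHoffman u} => multipleZeta u.1) '' {u | weight u.1 = n}) := by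
  unfold hoffmanSpan
  congr 1
  ext x
  simp only [Set.mem_setOf_eq, Set.mem_image, Subtype.exists, exists_and_left, exists_prop]
  constructor
  · rintro ⟨s, hs, hw, rfl⟩
    exact ⟨s, hw, hs, rfl⟩
  · rintro ⟨s, hw, hs, rfl⟩
    exact ⟨s, hs, hw, rfl⟩

/-! ## The split glue: grading × in-weight independence ⇒ the crux -/

/-- **SPLIT GLUE (crux-strategist 2026-08-17).** If the Hoffman weight spans form a direct sum in
`ℝ` (`iSupIndep hoffmanSpan`: Goncharov's grading conjecture on the Hoffman spans) and, within
each weight `n`, the `d_n` real Hoffman values are `ℚ`-linearly independent (Zagier's dimension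
lower bound in Brown's basis), then ALL real Hoffman values are `ℚ`-linearly independent — the
crux `HoffmanIndependence` BY NAME. Linear algebra: weight-wise independent families with
independent spans give an independent `Σ`-family (`linearIndependent_iUnion_finite`), and
`{2,3}^× ↪ Σ n, {u ∈ {2,3}^× : |u| = n}`, `u ↦ ⟨|u|, u⟩`, is compatible with the values.
[cite: Zagier1994, §9] [cite: GoncharovECM2001, Conjecture 1.1] -/
theorem HoffmanIndependence_of_subs : iSupIndep hoffmanSpan →
    (∀ n : ℕ, LinearIndependent ℚ
      (fun u : {u : List ℕ // IsHoffman u ∧ weight u = n} => multipleZeta u.1)) →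
    HoffmanIndependence := by
  intro hG hW
  -- the grading hypothesis, rewritten on the spans of the weight-wise ranges
  have hG' : iSupIndep fun n => Submodule.span ℚ (Set.range
      fun u : {u : List ℕ // IsHoffman u ∧ weight u = n} => multipleZeta u.1) := by
    have hfun : (fun n => Submodule.span ℚ (Set.range
        fun u : {u : List ℕ // IsHoffman u ∧ weight u = n} => multipleZeta u.1)) = hoffmanSpan :=
      funext span_range_hoffman_weight
    rw [hfun]
    exact hG
  -- the Σ-family over all weights is independent
  have hsigma : LinearIndependent ℚ
      fun ji : Σ n, {u : List ℕ // IsHoffman u ∧ weight u = n} => multipleZeta ji.2.1 :=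
    linearIndependent_iUnion_finite
      (f := fun n (u : {u : List ℕ // IsHoffman u ∧ weight u = n}) => multipleZeta u.1)
      hW fun _ _ _ hit => hG'.disjoint_biSup hit
  -- reindex the Hoffman indices by weight
  let e : {u : List ℕ // IsHoffman u} → Σ n, {u : List ℕ // IsHoffman u ∧ weight u = n} :=
    fun u => ⟨weight u.1, ⟨u.1, u.2, rfl⟩⟩
  have he : Function.Injective e :=
    Function.Injective.of_comp
      (f := fun ji : Σ n, {u : List ℕ // IsHoffman u ∧ weight u = n} => ji.2.1)
      Subtype.val_injective
  exact hsigma.comp e he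

/-! ## The converses: the split is exact -/

/-- The crux gives in-weight independence (restrict the independent family to a weight slice).
[folklore] -/
theorem inWeight_of_hoffmanIndependence (h : HoffmanIndependence) (n : ℕ) :
    LinearIndependent ℚ
      (fun u : {u : List ℕ // IsHoffman u ∧ weight u = n} => multipleZeta u.1) := by
  have h' : LinearIndependent ℚ (fun u : {u : List ℕ // IsHoffman u} => multipleZeta u.1) := h
  exact h'.comp (fun u : {u : List ℕ // IsHoffman u ∧ weight u = n} =>
      (⟨u.1, u.2.1⟩ : {u : List ℕ // IsHoffman u}))
    fun a b hab => Subtype.ext (by have h := congrArg Subtype.val hab; exact h)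

/-- The crux gives the grading of the Hoffman spans: spans of disjoint sub-families of an
independent family are disjoint subspaces (`LinearIndependent.disjoint_span_image`). [folklore] -/
theorem weightGrading_of_hoffmanIndependence (h : HoffmanIndependence) : iSupIndep hoffmanSpan := by
  have h' : LinearIndependent ℚ (fun u : {u : List ℕ // IsHoffman u} => multipleZeta u.1) := h
  rw [iSupIndep_def]
  intro n
  have hdisj : Disjoint ({u : {u : List ℕ // IsHoffman u} | weight u.1 = n})
      {u : {u : List ℕ // IsHoffman u} | weight u.1 ≠ n} :=
    Set.disjoint_left.2 fun u hu hu' => hu' hu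
  have key := h'.disjoint_span_image hdisj
  refine key.mono ?_ ?_
  · exact (hoffmanSpan_eq_span_image n).le
  · refine iSup₂_le fun j hj => ?_
    rw [hoffmanSpan_eq_span_image j]
    refine Submodule.span_mono (Set.image_mono ?_)
    intro u hu
    exact fun h => hj ((show weight u.1 = j from hu).symm.trans h)

/-- **The split is exact**: `HoffmanIndependence ⟺ (grading of the Hoffman spans) ∧ (in-weight
independence)`. Neither conjunct is the crux reworded: the first is silent inside a weight
(it allows `ζ(2,3) ∈ ℚζ(3,2)`), the second is silent across weights (it allows `ζ(3) ∈ ℚ + ℚπ²`).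
[folklore] -/
theorem hoffmanIndependence_iff_subs :
    HoffmanIndependence ↔
      iSupIndep hoffmanSpan ∧ ∀ n : ℕ, LinearIndependent ℚ
        (fun u : {u : List ℕ // IsHoffman u ∧ weight u = n} => multipleZeta u.1) :=
  ⟨fun h => ⟨weightGrading_of_hoffmanIndependence h, inWeight_of_hoffmanIndependence h⟩,
    fun h => HoffmanIndependence_of_subs h.1 h.2⟩

/-! ## The sub-cruxes against the printed conjectures -/

/-- **Sub-crux 1 ⇐ Goncharov's weight-grading conjecture.** `MZVWeightGradingConjecture`
(`iSupIndep mzvSpace`, GoncharovECM2001 Conj. 1.1 a)) gives the grading of the Hoffman spans,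
unconditionally (`hoffmanSpan n ≤ mzvSpace n`: a Hoffman index is admissible). Given Brown's
theorem the two statements coincide. [cite: GoncharovECM2001, Conjecture 1.1] -/
theorem weightGrading_of_gradingConjecture (hG : MZVWeightGradingConjecture) :
    iSupIndep hoffmanSpan :=
  hG.mono hoffmanSpan_le_mzvSpace

/-- Given Brown's theorem `hoffmanSpan_eq_mzvSpace`, sub-crux 1 IS Goncharov's grading conjecture.
[cite: Brown2012, Theorem 1.1] -/
theorem weightGrading_iff_gradingConjecture (hB : hoffmanSpan_eq_mzvSpace) :
    iSupIndep hoffmanSpan ↔ MZVWeightGradingConjecture := by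
  have hfun : hoffmanSpan = mzvSpace := funext hB
  unfold MZVWeightGradingConjecture
  rw [hfun]

/-- **Sub-crux 2, weight by weight, is a dimension statement**: the weight-`n` Hoffman values are
independent iff `d_n ≤ dim_ℚ hoffmanSpan n` (there are exactly `d_n` of them,
`zagierDim_eq_card_hoffman_holds`; `d_n` vectors are independent iff their span has dimension
`≥ d_n`, `linearIndependent_iff_card_le_finrank_span`). The reverse inequality is the trivial count
`finrank_hoffmanSpan_le_zagierDim`. [cite: Zagier1994, §9] -/
theorem inWeight_iff_zagierDim_le_finrank (n : ℕ) :
    LinearIndependent ℚ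
        (fun u : {u : List ℕ // IsHoffman u ∧ weight u = n} => multipleZeta u.1) ↔
      zagierDim n ≤ Module.finrank ℚ (hoffmanSpan n) := by
  haveI := finite_hoffman n
  letI := Fintype.ofFinite {u : List ℕ // IsHoffman u ∧ weight u = n}
  rw [linearIndependent_iff_card_le_finrank_span]
  unfold Set.finrank
  rw [span_range_hoffman_weight, ← Nat.card_eq_fintype_card, ← zagierDim_eq_card_hoffman_holds n]

/-- Sub-crux 2 in dimension form: `∀ n, dim_ℚ hoffmanSpan n = d_n`. [cite: Zagier1994, §9] -/
theorem inWeight_iff_finrank_eq :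
    (∀ n : ℕ, LinearIndependent ℚ
        (fun u : {u : List ℕ // IsHoffman u ∧ weight u = n} => multipleZeta u.1)) ↔
      ∀ n : ℕ, Module.finrank ℚ (hoffmanSpan n) = zagierDim n := by
  refine forall_congr' fun n => ?_
  rw [inWeight_iff_zagierDim_le_finrank]
  exact ⟨fun h => le_antisymm (finrank_hoffmanSpan_le_zagierDim n) h, fun h => h.ge⟩

/-- **Sub-crux 2 ⇐ Zagier's dimension conjecture + Brown's theorem**: if `dim_ℚ 𝒵_n = d_n` and the
weight-`n` Hoffman values span `𝒵_n`, they are independent. [cite: Zagier1994, §9] [cite: Brown2012, Theorem 1.1] -/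
theorem inWeight_of_dimensionConjecture (hZ : ZagierDimensionConjecture)
    (hB : hoffmanSpan_eq_mzvSpace) (n : ℕ) :
    LinearIndependent ℚ
      (fun u : {u : List ℕ // IsHoffman u ∧ weight u = n} => multipleZeta u.1) := by
  rw [inWeight_iff_zagierDim_le_finrank, hB n, hZ n]

/-- **Unconditional rungs of sub-crux 2**: in weights `n ≤ 4` (`d_n ≤ 1`; `dim 𝒵_n = d_n` is a
theorem there, `finrank_mzvSpace_eq_zagierDim_of_le_four`, and Brown's theorem is unconditional in
the tree through weight 9, `hoffmanSpan_eq_mzvSpace_of_le_nine`) the weight-`n` Hoffman values are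
independent. The first open weight is `n = 5` (`{ζ(2,3), ζ(3,2)}` ⟺ `ζ(5) ∉ ℚζ(2)ζ(3)`).
[cite: Zagier1994, §9] -/
theorem inWeight_of_le_four {n : ℕ} (hn : n ≤ 4) :
    LinearIndependent ℚ
      (fun u : {u : List ℕ // IsHoffman u ∧ weight u = n} => multipleZeta u.1) := by
  rw [inWeight_iff_zagierDim_le_finrank, hoffmanSpan_eq_mzvSpace_of_le_nine (by omega),
    finrank_mzvSpace_eq_zagierDim_of_le_four hn]

/-- **The crux from the two printed conjectures** (re-derivation through the split; cf. the
two-posets line's `stub_hoffmanIndependentOfZagier`): Goncharov's grading conjecture, Zagier's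
dimension conjecture and Brown's theorem give `HoffmanIndependence`.
[cite: Zagier1994, §9] [cite: GoncharovECM2001, Conjecture 1.1] [cite: Brown2012, Theorem 1.1] -/
theorem hoffmanIndependence_of_zagier_goncharov_brown (hG : MZVWeightGradingConjecture)
    (hZ : ZagierDimensionConjecture) (hB : hoffmanSpan_eq_mzvSpace) : HoffmanIndependence :=
  HoffmanIndependence_of_subs (weightGrading_of_gradingConjecture hG)
    (inWeight_of_dimensionConjecture hZ hB)

end Summit.KontsevichZagierPeriods.LinRedNormalForm.HoffmanIndependence
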